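import Mathlib
import HarnessLib

/-!
# The exact synchronization condition for acyclic (radial) lossless networks
# (Dörfler–Chertkov–Bullo 2013, SI Theorem 1 (1) and Theorem 2 (G1))

Topic `Literature/MathematicalPhysics/PowerSystems`, namespace
`Literature.MathematicalPhysics.PowerSystems.ClassicalModel.RadialNetwork`.
Everything below is PROVED from Mathlib (no definitions, no named facts, no new axioms).

Source (held, read this session): F. Dörfler, M. Chertkov, F. Bullo, *Synchronization in complex
oscillator networks and smart grids*, PNAS 110 (2013) 2005–2010, Supporting Information §3
[DorflerChertkovBullo2013; arXiv:1208.0045, chunks p0017–p0019].  Fixed-point (synchronization /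
lossless power-flow) equations `ω_i = Σ_j a_ij sin(θ_i − θ_j)` with `ω ∈ 𝟙ₙ^⊥`; auxiliary form
`ω = B diag(a_ij) ψ`, `ψ = sin(Bᵀθ)`.
> **SI Theorem 1 (Properties of the fixed point equations)** «1) Exact solution: Every solution of
> the auxiliary fixed-point equations is of the form ψ = BᵀL†ω + ψ_hom, where the homogeneous
> solution ψ_hom satisfies diag(a_ij) ψ_hom ∈ Ker(B).»
> **SI Theorem 2 (G1) Exact synchronization condition for acyclic graphs**: «Assume that G(V,E,A)
> is acyclic. There exists an exponentially stable equilibrium θ* ∈ Δ̄_G(γ) if and only if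
> condition [‖BᵀL†ω‖_∞ ≤ sin(γ)] holds. Moreover, in this case we have that
> Bᵀθ* = arcsin(BᵀL†ω) ∈ Δ̄_G(γ)»; proof: «For an acyclic graph we have that Ker(B) = ∅.
> According to Theorem 1 there exists an equilibrium θ* ∈ Δ̄_G(γ) if and only if condition … is
> satisfied. In this case, we obtain Bᵀθ* = arcsin(BᵀL†ω).»
Main text (chunk p0006): «The synchronization condition (2) is necessary and sufficient for (i) the
sparsest (acyclic) … network topologies»; circuit reading (chunk p0019): «Let x ∈ ℝ^|E| satisfy
Bx = ω, then x corresponds to equivalent power injections along lines … x is not uniquely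
determined if the circuit features loops» — on a tree it is.

## Rendering (tree vocabulary: unbundled couplings `C : Fin n → Fin n → ℝ`, injections `P`)

A RADIAL (acyclic, connected) network on the nodes `Fin n` is presented by parent pointers: a
`root`, `parent : Fin n → Fin n` and `depth : Fin n → ℕ` with `depth root = 0` and
`depth i = depth (parent i) + 1` for `i ≠ root` (so every non-root node hangs on the tree edge
`{i, parent i}`); the symmetric coupling matrix `C` is SUPPORTED ON TREE EDGES (`C i j ≠ 0`, `i ≠ j`
⇒ `j = parent i` or `i = parent j`), with `a_i := C i (parent i) > 0` the weight of the edge above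
`i` (the diagonal of `C` is unconstrained, `sin 0 = 0`).  The lossless flow map is
`F_i(θ) = Σ_j C_ij sin(θ_i − θ_j)` as in every file of this topic.

`BᵀL†ω` on a tree.  By SI Theorem 1 (1) with `Ker(B) = 0`, `diag(a) BᵀL†ω` is THE solution `u`
of the linear flow-conservation system `B u = ω`; on the rooted tree this system reads, node by
node, `P_i = u_i − Σ_{j : parent j = i} u_j` (`u_i` = the flow on the edge `i → parent i`; at the
root the first term is absent).  We therefore take the EDGE FLOWS `u` as data together with these
`n` conservation identities (rational, checkable per instance) and PROVE their uniqueness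
(`treeFlow_unique`), so that `u_i / a_i` is the printed `(BᵀL†ω)` on the edge above `i`.

Results: (⇐, with the explicit solution) if `|u_i| ≤ a_i sin γ` on every edge (`0 ≤ γ ≤ π/2`)
then the angle vector defined down the tree by `θ_root = 0`, `θ_i = θ_{parent i} + arcsin(u_i/a_i)`
is a synchronous equilibrium `F(θ) = P` in `Δ̄_G(γ)` with `Bᵀθ = arcsin(u/a)`
(`exists_equilibrium_of_treeFlow_le`); (⇒) every equilibrium in `Δ̄_G(γ)` has edge sines
`a_i sin(θ_i − θ_{parent i}) = u_i`, hence `|u_i| ≤ a_i sin γ` and `θ_i − θ_{parent i} =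
arcsin(u_i/a_i)` (`treeFlow_le_of_equilibrium`, `lineAngle_eq_arcsin_of_equilibrium`); together the
printed «if and only if» (`exists_equilibrium_iff_treeFlow_le`).  The «exponentially stable» clause
(linearisation, SI Lemma 2 (2)) is not typed here; uniqueness in `Δ̄_G(π/2)` is
`PhaseCohesiveEquilibriumUniqueness.lean`.

MODELLED: lossless, constant voltage magnitudes, RADIAL topology (distribution feeders, radial
microgrids; first-order coupled oscillators and the equilibria of classical / structure-preserving /
droop-inverter models share these equations).  No statement below says a grid is stable.
-/

namespace Literature.MathematicalPhysics.PowerSystems.ClassicalModel.RadialNetwork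

open Real Finset

variable {n : ℕ}

/-! ## Rooted-tree bookkeeping -/

/-- On a rooted tree presented by parent pointers and depths, a non-root node is not its own
parent. [cite: DorflerChertkovBullo2013, SI §3.2 Thm 2 (G1) («acyclic»)] -/
theorem parent_ne_self {root : Fin n} {parent : Fin n → Fin n} {depth : Fin n → ℕ}
    (hdepth : ∀ i, i ≠ root → depth i = depth (parent i) + 1) {i : Fin n} (hi : i ≠ root) :
    parent i ≠ i := by
  intro h
  have := hdepth i hi
  rw [h] at this
  omega

/-- … and is not the parent of its parent (no 2-cycles).
[cite: DorflerChertkovBullo2013, SI §3.2 Thm 2 (G1) («acyclic»)] -/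
theorem parent_parent_ne_self {root : Fin n} {parent : Fin n → Fin n} {depth : Fin n → ℕ}
    (hdepth : ∀ i, i ≠ root → depth i = depth (parent i) + 1) {i : Fin n} (hi : i ≠ root)
    (hpi : parent i ≠ root) : parent (parent i) ≠ i := by
  intro h
  have h1 := hdepth i hi
  have h2 := hdepth (parent i) hpi
  rw [h] at h2
  omega

/-- **Splitting a nodal sum over a tree-supported coupling**: for `C` supported on the tree edges
and any two-argument summand weights `g` with `g i i`-term killed by a factor vanishing on the
diagonal, `Σ_j C_ij s_ij = C_{i,parent i} s_{i,parent i} + Σ_{children j of i} C_ij s_ij`, where the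
first term is absent at the root and `s_ii = 0`.
[cite: DorflerChertkovBullo2013, SI §3.1 (fixed-point equations ω = B diag(a_ij) ψ on a graph)] -/
theorem sum_coupling_eq_parent_add_children {root : Fin n} {parent : Fin n → Fin n}
    {depth : Fin n → ℕ} (hdepth : ∀ i, i ≠ root → depth i = depth (parent i) + 1)
    (C : Fin n → Fin n → ℝ)
    (htree : ∀ i j, i ≠ j → C i j ≠ 0 → (i ≠ root ∧ j = parent i) ∨ (j ≠ root ∧ i = parent j))
    (s : Fin n → Fin n → ℝ) (hs : ∀ i, s i i = 0) (i : Fin n) :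
    ∑ j, C i j * s i j
      = (if i ≠ root then C i (parent i) * s i (parent i) else 0)
        + ∑ j ∈ Finset.univ.filter (fun j => j ≠ root ∧ parent j = i), C i j * s i j := by
  classical
  set ch : Finset (Fin n) := Finset.univ.filter (fun j => j ≠ root ∧ parent j = i) with hch
  -- the support set
  set T : Finset (Fin n) := (if i ≠ root then {parent i} else ∅) ∪ ch with hT
  have hsub : ∀ j ∈ Finset.univ, j ∉ T → C i j * s i j = 0 := by
    intro j _ hj
    by_cases hij : i = j
    · subst hij; rw [hs]; ring
    by_cases hC : C i j = 0
    · rw [hC]; ring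
    exfalso
    apply hj
    rcases htree i j hij hC with ⟨hi, hjp⟩ | ⟨hjr, hip⟩
    · rw [hT, Finset.mem_union, if_pos hi, hjp]
      left
      exact Finset.mem_singleton_self _
    · rw [hT, Finset.mem_union]
      right
      rw [hch, Finset.mem_filter]
      exact ⟨Finset.mem_univ _, hjr, hip.symm⟩
  rw [← Finset.sum_subset (Finset.subset_univ T) hsub]
  -- the two pieces of T are disjoint
  have hdisj : Disjoint (if i ≠ root then ({parent i} : Finset (Fin n)) else ∅) ch := by
    by_cases hi : i ≠ root
    · rw [if_pos hi, Finset.disjoint_singleton_left, hch, Finset.mem_filter]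
      rintro ⟨-, hpr, hpp⟩
      exact parent_parent_ne_self hdepth hi hpr hpp
    · rw [if_neg hi]
      exact Finset.disjoint_empty_left _
  rw [hT, Finset.sum_union hdisj]
  congr 1
  by_cases hi : i ≠ root
  · rw [if_pos hi, if_pos hi, Finset.sum_singleton]
  · rw [if_neg hi, if_neg hi, Finset.sum_empty]

/-! ## Uniqueness of tree flows (SI Theorem 1 (1) with `Ker B = 0`) -/

/-- **Flows on a tree are determined by the injections**: if `d` satisfies the HOMOGENEOUS
conservation law `[i ≠ root]·d_i = Σ_{children j of i} d_j` at every node, then `d_i = 0` at every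
non-root node (there is no cycle space: «for an acyclic graph we have that Ker(B) = ∅»).
[cite: DorflerChertkovBullo2013, SI §3.1 Thm 1 (1) and §3.2 Thm 2 (G1) proof (Ker(B) = ∅)] -/
theorem treeFlow_unique {root : Fin n} {parent : Fin n → Fin n} {depth : Fin n → ℕ}
    (hdepth : ∀ i, i ≠ root → depth i = depth (parent i) + 1) (d : Fin n → ℝ)
    (hcons : ∀ i, (if i ≠ root then d i else 0)
      = ∑ j ∈ Finset.univ.filter (fun j => j ≠ root ∧ parent j = i), d j) :
    ∀ i, i ≠ root → d i = 0 := by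
  classical
  -- induct downward on the depth, from the deepest nodes
  set N : ℕ := Finset.univ.sup depth with hN
  have hle : ∀ j, depth j ≤ N := fun j => Finset.le_sup (f := depth) (Finset.mem_univ j)
  suffices h : ∀ m : ℕ, ∀ i, N - depth i = m → i ≠ root → d i = 0 from
    fun i hi => h (N - depth i) i rfl hi
  intro m
  induction m using Nat.strong_induction_on with
  | _ m ih =>
    intro i hm hi
    have hci := hcons i
    rw [if_pos hi] at hci
    rw [hci]
    refine Finset.sum_eq_zero fun j hj => ?_
    simp only [Finset.mem_filter, Finset.mem_univ, true_and] at hj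
    have hdj : depth j = depth i + 1 := by rw [hdepth j hj.1, hj.2]
    have hjN := hle j
    exact ih (N - depth j) (by omega) j rfl hj.1

/-! ## The flow form of the fixed-point equations on a tree -/

/-- On a tree-supported lossless network the nodal flow `F_i(θ) = Σ_j C_ij sin(θ_i − θ_j)` is the
flow up the edge above `i` minus the flows arriving from the children:
`F_i(θ) = [i ≠ root]·a_i sin(θ_i − θ_{parent i}) − Σ_{children j} a_j sin(θ_j − θ_{parent j})`
(`C` symmetric). [cite: DorflerChertkovBullo2013, SI §3.1 (ω = B diag(a_ij) ψ, ψ = sin(Bᵀθ))] -/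
theorem flow_eq_treeFlow {root : Fin n} {parent : Fin n → Fin n} {depth : Fin n → ℕ}
    (hdepth : ∀ i, i ≠ root → depth i = depth (parent i) + 1)
    (C : Fin n → Fin n → ℝ) (hC : ∀ i j, C i j = C j i)
    (htree : ∀ i j, i ≠ j → C i j ≠ 0 → (i ≠ root ∧ j = parent i) ∨ (j ≠ root ∧ i = parent j))
    (θ : Fin n → ℝ) (i : Fin n) :
    ∑ j, C i j * Real.sin (θ i - θ j)
      = (if i ≠ root then C i (parent i) * Real.sin (θ i - θ (parent i)) else 0)
        - ∑ j ∈ Finset.univ.filter (fun j => j ≠ root ∧ parent j = i),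
            C j (parent j) * Real.sin (θ j - θ (parent j)) := by
  classical
  rw [sum_coupling_eq_parent_add_children hdepth C htree (fun i j => Real.sin (θ i - θ j))
    (fun i => by simp) i]
  have hch : ∑ j ∈ Finset.univ.filter (fun j => j ≠ root ∧ parent j = i),
      C i j * Real.sin (θ i - θ j)
      = -∑ j ∈ Finset.univ.filter (fun j => j ≠ root ∧ parent j = i),
          C j (parent j) * Real.sin (θ j - θ (parent j)) := by
    rw [← Finset.sum_neg_distrib]
    refine Finset.sum_congr rfl fun j hj => ?_
    simp only [Finset.mem_filter, Finset.mem_univ, true_and] at hj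
    rw [hj.2, hC i j, show θ i - θ j = -(θ j - θ i) by ring, Real.sin_neg]
    ring
  rw [hch]
  ring

/-! ## (G1) «⇒»: an equilibrium in `Δ̄_G(γ)` forces `|u_i| ≤ a_i sin γ` and `Bᵀθ = arcsin(u/a)` -/

/-- **Necessity half of the exact condition, with the printed identity `Bᵀθ* = arcsin(BᵀL†ω)`**:
let `u` be edge flows satisfying conservation `P_i = [i ≠ root]·u_i − Σ_{children j} u_j` at every
node, and `θ` a synchronous equilibrium `F(θ) = P` with `|θ_i − θ_{parent i}| ≤ γ ≤ π/2` on every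
edge.  Then on every edge `a_i sin(θ_i − θ_{parent i}) = u_i`, `|u_i| ≤ a_i sin γ`, and
`θ_i − θ_{parent i} = arcsin(u_i / a_i)`.
[cite: DorflerChertkovBullo2013, SI §3.2 Thm 2 (G1) («only if»; «Bᵀθ* = arcsin(BᵀL†ω)»)] -/
theorem treeFlow_le_of_equilibrium {root : Fin n} {parent : Fin n → Fin n} {depth : Fin n → ℕ}
    (hdepth : ∀ i, i ≠ root → depth i = depth (parent i) + 1)
    (C : Fin n → Fin n → ℝ) (hC : ∀ i j, C i j = C j i)
    (htree : ∀ i j, i ≠ j → C i j ≠ 0 → (i ≠ root ∧ j = parent i) ∨ (j ≠ root ∧ i = parent j))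
    (ha : ∀ i, i ≠ root → 0 < C i (parent i)) (P u : Fin n → ℝ)
    (hcons : ∀ i, P i = (if i ≠ root then u i else 0)
      - ∑ j ∈ Finset.univ.filter (fun j => j ≠ root ∧ parent j = i), u j)
    {γ : ℝ} (hγ0 : 0 ≤ γ) (hγ : γ ≤ π / 2) (θ : Fin n → ℝ)
    (heq : ∀ i, ∑ j, C i j * Real.sin (θ i - θ j) = P i)
    (hcoh : ∀ i, i ≠ root → |θ i - θ (parent i)| ≤ γ) :
    ∀ i, i ≠ root →
      C i (parent i) * Real.sin (θ i - θ (parent i)) = u i ∧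
      |u i| ≤ C i (parent i) * Real.sin γ ∧
      θ i - θ (parent i) = Real.arcsin (u i / C i (parent i)) := by
  classical
  -- the difference of the two flow vectors is a homogeneous tree flow, hence zero
  set v : Fin n → ℝ := fun i => C i (parent i) * Real.sin (θ i - θ (parent i)) with hv
  have hzero := treeFlow_unique hdepth (fun i => v i - u i) (fun i => by
    have h1 := heq i
    rw [flow_eq_treeFlow hdepth C hC htree θ i, hcons i] at h1
    rw [Finset.sum_sub_distrib]
    by_cases hi : i ≠ root
    · rw [if_pos hi, if_pos hi] at h1
      rw [if_pos hi]
      simp only [hv]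
      linarith
    · rw [if_neg hi, if_neg hi] at h1
      rw [if_neg hi]
      simp only [hv]
      linarith)
  intro i hi
  have h1 : v i = u i := by have := hzero i hi; linarith
  have hapos := ha i hi
  have hane : C i (parent i) ≠ 0 := hapos.ne'
  have hsin : Real.sin (θ i - θ (parent i)) = u i / C i (parent i) := by
    rw [← h1]; simp only [hv]; field_simp
  refine ⟨h1, ?_, ?_⟩
  · -- |u_i| = a_i |sin| ≤ a_i sin γ
    rw [← h1]
    simp only [hv]
    rw [abs_mul, abs_of_pos hapos]
    refine mul_le_mul_of_nonneg_left ?_ hapos.le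
    rw [Real.abs_sin_eq_sin_abs_of_abs_le_pi (by linarith [hcoh i hi, Real.pi_pos])]
    exact Real.sin_le_sin_of_le_of_le_pi_div_two (by linarith [abs_nonneg (θ i - θ (parent i)),
      Real.pi_pos]) hγ (hcoh i hi)
  · rw [← hsin, Real.arcsin_sin]
    · linarith [(abs_le.mp (hcoh i hi)).1]
    · linarith [(abs_le.mp (hcoh i hi)).2]

/-! ## (G1) «⇐»: the explicit solution down the tree -/

/-- **Sufficiency half with the explicit equilibrium**: if the tree flows satisfy
`|u_i| ≤ a_i sin γ` on every edge (`0 ≤ γ ≤ π/2`), then there is a synchronous equilibrium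
`F(θ) = P` with `θ_root = 0`, `θ_i − θ_{parent i} = arcsin(u_i/a_i)` («Bᵀθ* = arcsin(BᵀL†ω)») and
`|θ_i − θ_{parent i}| ≤ γ` on every edge (θ* ∈ Δ̄_G(γ)).
[cite: DorflerChertkovBullo2013, SI §3.2 Thm 2 (G1) («if»; explicit solution)] -/
theorem exists_equilibrium_of_treeFlow_le {root : Fin n} {parent : Fin n → Fin n}
    {depth : Fin n → ℕ} (hroot : depth root = 0)
    (hdepth : ∀ i, i ≠ root → depth i = depth (parent i) + 1)
    (C : Fin n → Fin n → ℝ) (hC : ∀ i j, C i j = C j i)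
    (htree : ∀ i j, i ≠ j → C i j ≠ 0 → (i ≠ root ∧ j = parent i) ∨ (j ≠ root ∧ i = parent j))
    (ha : ∀ i, i ≠ root → 0 < C i (parent i)) (P u : Fin n → ℝ)
    (hcons : ∀ i, P i = (if i ≠ root then u i else 0)
      - ∑ j ∈ Finset.univ.filter (fun j => j ≠ root ∧ parent j = i), u j)
    {γ : ℝ} (hγ0 : 0 ≤ γ) (hγ : γ ≤ π / 2)
    (hu : ∀ i, i ≠ root → |u i| ≤ C i (parent i) * Real.sin γ) :
    ∃ θ : Fin n → ℝ, θ root = 0 ∧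
      (∀ i, i ≠ root → θ i - θ (parent i) = Real.arcsin (u i / C i (parent i))) ∧
      (∀ i, i ≠ root → |θ i - θ (parent i)| ≤ γ) ∧
      (∀ i, ∑ j, C i j * Real.sin (θ i - θ j) = P i) := by
  classical
  -- define the angles by recursion on the depth
  let f : ℕ → Fin n → ℝ := fun k => Nat.rec (fun _ => (0 : ℝ))
    (fun _ g => fun i => if i = root then 0 else g (parent i) + Real.arcsin (u i / C i (parent i))) k
  set θ : Fin n → ℝ := fun i => f (depth i) i with hθ
  have hθroot : θ root = 0 := by simp [hθ, f, hroot]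
  have hstep : ∀ i, i ≠ root → θ i - θ (parent i) = Real.arcsin (u i / C i (parent i)) := by
    intro i hi
    have : θ i = θ (parent i) + Real.arcsin (u i / C i (parent i)) := by
      show f (depth i) i = f (depth (parent i)) (parent i) + _
      rw [hdepth i hi]
      simp [f, hi]
    linarith
  -- edge sines and cohesiveness
  have hratio : ∀ i, i ≠ root → |u i / C i (parent i)| ≤ Real.sin γ := by
    intro i hi
    rw [abs_div, abs_of_pos (ha i hi), div_le_iff₀ (ha i hi), mul_comm]
    exact hu i hi
  have hsinγ1 : Real.sin γ ≤ 1 := Real.sin_le_one γ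
  have hsin : ∀ i, i ≠ root → C i (parent i) * Real.sin (θ i - θ (parent i)) = u i := by
    intro i hi
    have hane : C i (parent i) ≠ 0 := (ha i hi).ne'
    rw [hstep i hi, Real.sin_arcsin]
    · field_simp
    · linarith [(abs_le.mp (hratio i hi)).1]
    · linarith [(abs_le.mp (hratio i hi)).2]
  have hcoh : ∀ i, i ≠ root → |θ i - θ (parent i)| ≤ γ := by
    intro i hi
    rw [hstep i hi, abs_le]
    have h1 := (abs_le.mp (hratio i hi))
    constructor
    · have : Real.arcsin (-Real.sin γ) ≤ Real.arcsin (u i / C i (parent i)) :=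
        Real.arcsin_le_arcsin h1.1
      rwa [Real.arcsin_neg, Real.arcsin_sin (by linarith [Real.pi_pos]) (by linarith)] at this
    · have : Real.arcsin (u i / C i (parent i)) ≤ Real.arcsin (Real.sin γ) :=
        Real.arcsin_le_arcsin h1.2
      rwa [Real.arcsin_sin (by linarith [Real.pi_pos]) (by linarith)] at this
  refine ⟨θ, hθroot, hstep, hcoh, fun i => ?_⟩
  rw [flow_eq_treeFlow hdepth C hC htree θ i, hcons i]
  congr 1
  · by_cases hi : i ≠ root
    · rw [if_pos hi, if_pos hi, hsin i hi]
    · rw [if_neg hi, if_neg hi]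
  · refine Finset.sum_congr rfl fun j hj => ?_
    simp only [Finset.mem_filter, Finset.mem_univ, true_and] at hj
    exact hsin j hj.1

/-! ## (G1) as printed: «if and only if» -/

/-- **Exact synchronization condition for acyclic graphs** [DCB 2013 SI Thm 2 (G1)]: on a radial
lossless network (rooted-tree presentation, couplings supported on tree edges, `a_i > 0`), with the
tree flows `u` of the injections `P` (conservation at every node) and `0 ≤ γ ≤ π/2`:
there is a synchronous equilibrium with `|θ_i − θ_j| ≤ γ` across every line IF AND ONLY IF
`|u_i| ≤ a_i sin γ` on every edge (‖BᵀL†ω‖_∞ ≤ sin γ); in that case `Bᵀθ* = arcsin(u/a)`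
(previous two theorems). [cite: DorflerChertkovBullo2013, SI §3.2 Thm 2 (G1)] -/
theorem exists_equilibrium_iff_treeFlow_le {root : Fin n} {parent : Fin n → Fin n}
    {depth : Fin n → ℕ} (hroot : depth root = 0)
    (hdepth : ∀ i, i ≠ root → depth i = depth (parent i) + 1)
    (C : Fin n → Fin n → ℝ) (hC : ∀ i j, C i j = C j i)
    (htree : ∀ i j, i ≠ j → C i j ≠ 0 → (i ≠ root ∧ j = parent i) ∨ (j ≠ root ∧ i = parent j))
    (ha : ∀ i, i ≠ root → 0 < C i (parent i)) (P u : Fin n → ℝ)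
    (hcons : ∀ i, P i = (if i ≠ root then u i else 0)
      - ∑ j ∈ Finset.univ.filter (fun j => j ≠ root ∧ parent j = i), u j)
    {γ : ℝ} (hγ0 : 0 ≤ γ) (hγ : γ ≤ π / 2) :
    (∃ θ : Fin n → ℝ, (∀ i, ∑ j, C i j * Real.sin (θ i - θ j) = P i) ∧
        ∀ i j, i ≠ j → C i j ≠ 0 → |θ i - θ j| ≤ γ)
      ↔ ∀ i, i ≠ root → |u i| ≤ C i (parent i) * Real.sin γ := by
  constructor
  · rintro ⟨θ, heq, hcoh⟩ i hi
    have hcoh' : ∀ i, i ≠ root → |θ i - θ (parent i)| ≤ γ := fun i hi =>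
      hcoh i (parent i) (parent_ne_self hdepth hi).symm (ha i hi).ne'
    exact (treeFlow_le_of_equilibrium hdepth C hC htree ha P u hcons hγ0 hγ θ heq hcoh' i hi).2.1
  · intro hu
    obtain ⟨θ, -, -, hcoh, heq⟩ :=
      exists_equilibrium_of_treeFlow_le hroot hdepth C hC htree ha P u hcons hγ0 hγ hu
    refine ⟨θ, heq, fun i j hij hCij => ?_⟩
    rcases htree i j hij hCij with ⟨hi, hj⟩ | ⟨hj, hi⟩
    · rw [hj]; exact hcoh i hi
    · rw [hi, abs_sub_comm]; exact hcoh j hj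

/-! ## Finitely many synchronous states per period on a tree (all branches)

«On a tree-network, there is a unique flow distribution satisfying Kirchhoff's current law»
[DelabaysColettaJacquod2016, §3 before Thm 3.6; proof of Thm 3.6: «If m = n − 1, then G is a tree
and the flows on the lines are uniquely determined»] = SI Thm 1 (1) with `Ker(B) = ∅`: every edge
SINE of a synchronous state is determined, so a state is determined modulo `2π` by the BRANCH
(sign of the cosine) of each edge — at most `2ⁿ` pinned states per period, in particular finitely
many: the census hypothesis of `FiniteEquilibriumSetIsolation` holds on every radial network with
live edges WITHOUT any computation (contrast `UnicyclicNetworkEquilibria.lean`, one chord ⇒ one real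
census parameter). -/

/-- Two angles with the same sine and cosines of the same sign differ by a whole turn (private).
[folklore] [cite: DelabaysColettaJacquod2016, Def. 3.7] -/
private theorem exists_int_of_sin_eq_of_cos_nonneg_iff {x y : ℝ} (hs : Real.sin x = Real.sin y)
    (hc : (0 ≤ Real.cos x ↔ 0 ≤ Real.cos y)) : ∃ k : ℤ, x - y = k * (2 * π) := by
  have hcos : Real.cos x = Real.cos y := by
    have h2 : (Real.cos x - Real.cos y) * (Real.cos x + Real.cos y) = 0 := by
      have hx := Real.sin_sq_add_cos_sq x
      have hy := Real.sin_sq_add_cos_sq y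
      rw [hs] at hx
      nlinarith
    rcases mul_eq_zero.1 h2 with h | h
    · linarith
    · rcases le_or_gt 0 (Real.cos x) with hx | hx
      · have hy := hc.1 hx; linarith
      · have hy : Real.cos y < 0 := by
          by_contra hy; push Not at hy; exact absurd (hc.2 hy) (not_le.2 hx)
        linarith
  have h1 : Real.cos (x - y) = 1 := by
    rw [Real.cos_sub, hcos, hs]
    nlinarith [Real.sin_sq_add_cos_sq y]
  obtain ⟨k, hk⟩ := (Real.cos_eq_one_iff (x - y)).1 h1
  exact ⟨k, hk.symm⟩

/-- **On a tree, two synchronous states with the same injections and the same edge branches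
(signs of the edge cosines) agree modulo `2π` at every node** — pinned at the root and taken in the
period box `[−π, π)ⁿ`, they are EQUAL. Mechanism: the difference of their edge flows is a tree flow
of the zero injection, hence zero (`treeFlow_unique`); live edges ⇒ equal edge sines; equal branches
⇒ edge angles equal modulo `2π`; down the tree.
[cite: DorflerChertkovBullo2013, SI §3.1 Thm 1 (1), §3.2 Thm 2 proof («Ker(B) = ∅»)]
[cite: DelabaysColettaJacquod2016, §3 («unique flow distribution» on a tree), Def. 3.7] -/
theorem pinned_equilibrium_eq_of_branch_eq {root : Fin n} {parent : Fin n → Fin n}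
    {depth : Fin n → ℕ} (hdepth : ∀ i, i ≠ root → depth i = depth (parent i) + 1)
    (C : Fin n → Fin n → ℝ) (hC : ∀ i j, C i j = C j i)
    (htree : ∀ i j, i ≠ j → C i j ≠ 0 → (i ≠ root ∧ j = parent i) ∨ (j ≠ root ∧ i = parent j))
    (ha : ∀ i, i ≠ root → C i (parent i) ≠ 0) (P : Fin n → ℝ) {θ θ' : Fin n → ℝ}
    (hr : θ root = 0) (hbox : ∀ i, θ i ∈ Set.Ico (-π) π)
    (heq : ∀ i, ∑ j, C i j * Real.sin (θ i - θ j) = P i)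
    (hr' : θ' root = 0) (hbox' : ∀ i, θ' i ∈ Set.Ico (-π) π)
    (heq' : ∀ i, ∑ j, C i j * Real.sin (θ' i - θ' j) = P i)
    (hsign : ∀ i, i ≠ root →
      (0 ≤ Real.cos (θ i - θ (parent i)) ↔ 0 ≤ Real.cos (θ' i - θ' (parent i)))) :
    θ = θ' := by
  classical
  -- the flow differences are a tree flow of the zero injection
  set d : Fin n → ℝ := fun i =>
    C i (parent i) * Real.sin (θ i - θ (parent i)) - C i (parent i) * Real.sin (θ' i - θ' (parent i))
    with hd
  have hcons : ∀ i, (if i ≠ root then d i else 0)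
      = ∑ j ∈ Finset.univ.filter (fun j => j ≠ root ∧ parent j = i), d j := by
    intro i
    have h1 := heq i
    have h2 := heq' i
    rw [flow_eq_treeFlow hdepth C hC htree θ i] at h1
    rw [flow_eq_treeFlow hdepth C hC htree θ' i] at h2
    simp only [hd, Finset.sum_sub_distrib]
    split_ifs with hi
    · rw [if_pos hi] at h1 h2; linarith
    · rw [if_neg hi] at h1 h2; linarith
  have hzero := treeFlow_unique hdepth d hcons
  -- edge angles agree modulo 2π
  have hedge : ∀ i, i ≠ root →
      ∃ k : ℤ, (θ i - θ (parent i)) - (θ' i - θ' (parent i)) = k * (2 * π) := by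
    intro i hi
    refine exists_int_of_sin_eq_of_cos_nonneg_iff ?_ (hsign i hi)
    have h0 := hzero i hi
    simp only [hd] at h0
    exact mul_left_cancel₀ (ha i hi) (by linarith)
  -- node angles agree modulo 2π, down the tree
  have hnode : ∀ m : ℕ, ∀ i, depth i = m → ∃ k : ℤ, θ i - θ' i = k * (2 * π) := by
    intro m
    induction m using Nat.strong_induction_on with
    | _ m ih =>
      intro i hm
      by_cases hi : i = root
      · subst hi
        exact ⟨0, by rw [hr, hr']; simp⟩
      · have hdp : depth (parent i) < m := by
          have := hdepth i hi; omega
        obtain ⟨kp, hkp⟩ := ih _ hdp (parent i) rfl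
        obtain ⟨ke, hke⟩ := hedge i hi
        exact ⟨kp + ke, by push_cast; linarith⟩
  funext i
  obtain ⟨k, hk⟩ := hnode (depth i) i rfl
  obtain ⟨a1, a2⟩ := hbox i
  obtain ⟨b1, b2⟩ := hbox' i
  have hk0 : k = 0 := by
    have hlt : |(k : ℝ)| < 1 := by
      rw [abs_lt]
      constructor <;> nlinarith [Real.pi_pos]
    have : |k| < 1 := by exact_mod_cast hlt
    rw [abs_lt] at this
    omega
  rw [hk0] at hk
  simp only [Int.cast_zero, zero_mul] at hk
  linarith

/-- **Finitely many synchronous states per period on a tree** (pinned at the root, half-open period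
box): the census hypothesis of `FiniteEquilibriumSetIsolation.exists_levelIsolation_of_finite_pinned`
holds on every radial lossless network with live tree edges, for every injection vector, with no
computation. [cite: DelabaysColettaJacquod2016, §3 («On a tree-network, there is a unique flow
distribution satisfying Kirchhoff's current law»)] [cite: DorflerChertkovBullo2013, SI §3.1 Thm 1 (1)] -/
theorem finite_pinned_equilibria {root : Fin n} {parent : Fin n → Fin n}
    {depth : Fin n → ℕ} (hdepth : ∀ i, i ≠ root → depth i = depth (parent i) + 1)
    (C : Fin n → Fin n → ℝ) (hC : ∀ i j, C i j = C j i)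
    (htree : ∀ i j, i ≠ j → C i j ≠ 0 → (i ≠ root ∧ j = parent i) ∨ (j ≠ root ∧ i = parent j))
    (ha : ∀ i, i ≠ root → C i (parent i) ≠ 0) (P : Fin n → ℝ) :
    {θ : Fin n → ℝ | θ root = 0 ∧ (∀ i, θ i ∈ Set.Ico (-π) π) ∧
      ∀ i, ∑ j, C i j * Real.sin (θ i - θ j) = P i}.Finite := by
  classical
  refine Set.Finite.of_finite_image (f := fun θ : Fin n → ℝ =>
    fun i => decide (0 ≤ Real.cos (θ i - θ (parent i)))) (Set.toFinite _) ?_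
  rintro θ ⟨hr, hbox, heq⟩ θ' ⟨hr', hbox', heq'⟩ hk
  refine pinned_equilibrium_eq_of_branch_eq hdepth C hC htree ha P hr hbox heq hr' hbox' heq'
    fun i _ => ?_
  have h := congr_fun hk i
  simpa only [decide_eq_decide] using h

/-- **At most `2ⁿ` synchronous states per period on a tree with `n` nodes** (one per branch
pattern of the edges; the root's pattern entry is idle, so in fact `≤ 2ⁿ⁻¹`). [folklore]
[cite: DelabaysColettaJacquod2016, §3, Def. 3.7] [cite: DorflerChertkovBullo2013, SI §3.1 Thm 1 (1)] -/
theorem ncard_pinned_equilibria_le {root : Fin n} {parent : Fin n → Fin n}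
    {depth : Fin n → ℕ} (hdepth : ∀ i, i ≠ root → depth i = depth (parent i) + 1)
    (C : Fin n → Fin n → ℝ) (hC : ∀ i j, C i j = C j i)
    (htree : ∀ i j, i ≠ j → C i j ≠ 0 → (i ≠ root ∧ j = parent i) ∨ (j ≠ root ∧ i = parent j))
    (ha : ∀ i, i ≠ root → C i (parent i) ≠ 0) (P : Fin n → ℝ) :
    {θ : Fin n → ℝ | θ root = 0 ∧ (∀ i, θ i ∈ Set.Ico (-π) π) ∧
      ∀ i, ∑ j, C i j * Real.sin (θ i - θ j) = P i}.ncard ≤ 2 ^ n := by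
  classical
  have hmaps : Set.MapsTo (fun θ : Fin n → ℝ => fun i => decide (0 ≤ Real.cos (θ i - θ (parent i))))
      {θ : Fin n → ℝ | θ root = 0 ∧ (∀ i, θ i ∈ Set.Ico (-π) π) ∧
        ∀ i, ∑ j, C i j * Real.sin (θ i - θ j) = P i} (Set.univ : Set (Fin n → Bool)) :=
    fun _ _ => Set.mem_univ _
  have hinj : Set.InjOn (fun θ : Fin n → ℝ => fun i => decide (0 ≤ Real.cos (θ i - θ (parent i))))
      {θ : Fin n → ℝ | θ root = 0 ∧ (∀ i, θ i ∈ Set.Ico (-π) π) ∧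
        ∀ i, ∑ j, C i j * Real.sin (θ i - θ j) = P i} := by
    rintro θ ⟨hr, hbox, heq⟩ θ' ⟨hr', hbox', heq'⟩ hk
    refine pinned_equilibrium_eq_of_branch_eq hdepth C hC htree ha P hr hbox heq hr' hbox' heq'
      fun i _ => ?_
    have h := congr_fun hk i
    simpa only [decide_eq_decide] using h
  calc _ ≤ (Set.univ : Set (Fin n → Bool)).ncard :=
        Set.ncard_le_ncard_of_injOn _ hmaps hinj Set.finite_univ
    _ = 2 ^ n := by
        rw [Set.ncard_univ, Nat.card_eq_fintype_card, Fintype.card_fun, Fintype.card_bool,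
          Fintype.card_fin]

/-! ## Exactly `2ⁿ⁻¹` synchronous states per period on a tree with strictly feasible flows

Every branch pattern is realised (lay `arcsin(uᵢ/aᵢ)` or `π − arcsin(uᵢ/aᵢ)` down the tree and
reduce modulo `2π`), so with the previous section the pinned synchronous states of the period box
are in bijection with the `2ⁿ⁻¹` branch patterns; exactly one (all `+`) is phase-cohesive.
[folklore] [cite: DorflerChertkovBullo2013, SI §3.2 Thm 2 (G1)] [cite: DelabaysColettaJacquod2016, §3, Def. 3.7] -/

/-! ### Whole-turn shifts of the node angles -/

/-- Shifting every node angle by its own whole number of turns changes no flow. [folklore]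
[cite: DelabaysColettaJacquod2016, Def. 3.7] -/
theorem flow_sub_zsmul_two_pi (C : Fin n → Fin n → ℝ) (θ : Fin n → ℝ) (k : Fin n → ℤ)
    (i : Fin n) :
    ∑ j, C i j * Real.sin ((θ i - k i • (2 * π)) - (θ j - k j • (2 * π)))
      = ∑ j, C i j * Real.sin (θ i - θ j) := by
  refine Finset.sum_congr rfl fun j _ => ?_
  rw [show (θ i - k i • (2 * π)) - (θ j - k j • (2 * π))
      = (θ i - θ j) + ((k j - k i : ℤ) : ℝ) * (2 * π) by rw [zsmul_eq_mul, zsmul_eq_mul]; push_cast; ring,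
    Real.sin_add_int_mul_two_pi]

/-- … nor the cosine across any pair. [folklore] [cite: DelabaysColettaJacquod2016, Def. 3.7] -/
theorem cos_sub_zsmul_two_pi (θ : Fin n → ℝ) (k : Fin n → ℤ) (i j : Fin n) :
    Real.cos ((θ i - k i • (2 * π)) - (θ j - k j • (2 * π))) = Real.cos (θ i - θ j) := by
  rw [show (θ i - k i • (2 * π)) - (θ j - k j • (2 * π))
      = (θ i - θ j) + ((k j - k i : ℤ) : ℝ) * (2 * π) by rw [zsmul_eq_mul, zsmul_eq_mul]; push_cast; ring,
    Real.cos_add_int_mul_two_pi]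

/-! ### A synchronous state for EVERY branch pattern (strictly feasible tree flows) -/

/-- The edge angle of branch `b`: `arcsin x` on the `+` branch (`b = true`), `π − arcsin x` on the
`−` branch — same sine `x` (`|x| ≤ 1`). [cite: DelabaysColettaJacquod2016, Def. 3.7]
[cite: DorflerChertkovBullo2013, SI §3.2 Thm 2 (G1) («Bᵀθ* = arcsin(BᵀL†ω)», the `+` branch)] -/
theorem sin_branch (b : Bool) {x : ℝ} (hx : |x| < 1) :
    Real.sin (if b then Real.arcsin x else π - Real.arcsin x) = x := by
  have h1 := (abs_lt.mp hx).1
  have h2 := (abs_lt.mp hx).2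
  split_ifs
  · exact Real.sin_arcsin h1.le h2.le
  · rw [Real.sin_pi_sub]; exact Real.sin_arcsin h1.le h2.le

/-- … and cosine of the sign prescribed by `b` (strictly, `|x| < 1`).
[cite: DelabaysColettaJacquod2016, Def. 3.7] -/
theorem cos_branch_nonneg_iff (b : Bool) {x : ℝ} (hx : |x| < 1) :
    (0 ≤ Real.cos (if b then Real.arcsin x else π - Real.arcsin x) ↔ b = true) := by
  have hpos : 0 < Real.cos (Real.arcsin x) := by
    rw [Real.cos_arcsin]
    apply Real.sqrt_pos.2
    have := abs_lt.mp hx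
    nlinarith [sq_abs x]
  cases b
  · simp only [Bool.false_eq_true, if_false, iff_false, not_le, Real.cos_pi_sub]
    linarith
  · simp only [if_true, iff_true]
    exact hpos.le

/-- **A synchronous state for every branch pattern.** On a radial lossless network (rooted tree,
`C` symmetric and supported on the tree edges, `aᵢ = C_{i, parent i} > 0`) whose tree flows `u` of
the injections `P` are STRICTLY feasible (`|uᵢ| < aᵢ` on every edge), every assignment `σ` of a
branch to each edge is realised by a synchronous state `F(θ) = P`, pinned at the root and taken in
the period box `[−π, π)ⁿ`: lay the branch angles down the tree and reduce each node angle modulo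
`2π`. (The all-`+` pattern is the printed solution `Bᵀθ* = arcsin(BᵀL†ω)` of (G1).)
[cite: DorflerChertkovBullo2013, SI §3.2 Thm 2 (G1) (explicit solution down the tree)]
[cite: DelabaysColettaJacquod2016, §3 («unique flow distribution» on a tree), Def. 3.7] -/
theorem exists_pinned_equilibrium_of_branch {root : Fin n} {parent : Fin n → Fin n}
    {depth : Fin n → ℕ} (hroot : depth root = 0)
    (hdepth : ∀ i, i ≠ root → depth i = depth (parent i) + 1)
    (C : Fin n → Fin n → ℝ) (hC : ∀ i j, C i j = C j i)
    (htree : ∀ i j, i ≠ j → C i j ≠ 0 → (i ≠ root ∧ j = parent i) ∨ (j ≠ root ∧ i = parent j))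
    (ha : ∀ i, i ≠ root → 0 < C i (parent i)) (P u : Fin n → ℝ)
    (hcons : ∀ i, P i = (if i ≠ root then u i else 0)
      - ∑ j ∈ Finset.univ.filter (fun j => j ≠ root ∧ parent j = i), u j)
    (hu : ∀ i, i ≠ root → |u i| < C i (parent i)) (σ : Fin n → Bool) :
    ∃ θ : Fin n → ℝ, θ root = 0 ∧ (∀ i, θ i ∈ Set.Ico (-π) π) ∧
      (∀ i, ∑ j, C i j * Real.sin (θ i - θ j) = P i) ∧
      (∀ i, i ≠ root → (0 ≤ Real.cos (θ i - θ (parent i)) ↔ σ i = true)) := by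
  classical
  -- the branch edge angles, and their sine / cosine sign
  have hx : ∀ i, i ≠ root → |u i / C i (parent i)| < 1 := fun i hi => by
    rw [abs_div, abs_of_pos (ha i hi), div_lt_one (ha i hi)]; exact hu i hi
  set ψ : Fin n → ℝ := fun i =>
    if σ i then Real.arcsin (u i / C i (parent i)) else π - Real.arcsin (u i / C i (parent i)) with hψ
  -- raw angles by recursion on the depth
  let f : ℕ → Fin n → ℝ := fun k => Nat.rec (fun _ => (0 : ℝ))
    (fun _ g => fun i => if i = root then 0 else g (parent i) + ψ i) k
  set raw : Fin n → ℝ := fun i => f (depth i) i with hraw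
  have hrawroot : raw root = 0 := by simp [hraw, f, hroot]
  have hstep : ∀ i, i ≠ root → raw i - raw (parent i) = ψ i := by
    intro i hi
    have : raw i = raw (parent i) + ψ i := by
      show f (depth i) i = f (depth (parent i)) (parent i) + _
      rw [hdepth i hi]
      simp [f, hi]
    linarith
  have hsin : ∀ i, i ≠ root → C i (parent i) * Real.sin (raw i - raw (parent i)) = u i := by
    intro i hi
    rw [hstep i hi, hψ, sin_branch (σ i) (hx i hi)]
    field_simp [(ha i hi).ne']
  have hrawEq : ∀ i, ∑ j, C i j * Real.sin (raw i - raw j) = P i := by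
    intro i
    rw [flow_eq_treeFlow hdepth C hC htree raw i, hcons i]
    congr 1
    · by_cases hi : i ≠ root
      · rw [if_pos hi, if_pos hi, hsin i hi]
      · rw [if_neg hi, if_neg hi]
    · refine Finset.sum_congr rfl fun j hj => ?_
      simp only [Finset.mem_filter, Finset.mem_univ, true_and] at hj
      exact hsin j hj.1
  -- reduce modulo 2π into the period box
  set k : Fin n → ℤ := fun i => toIcoDiv Real.two_pi_pos (-π) (raw i) with hk
  set θ : Fin n → ℝ := fun i => raw i - k i • (2 * π) with hθ
  have hθmod : ∀ i, θ i = toIcoMod Real.two_pi_pos (-π) (raw i) := fun i =>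
    self_sub_toIcoDiv_zsmul Real.two_pi_pos (-π) (raw i)
  refine ⟨θ, ?_, fun i => ?_, fun i => ?_, fun i hi => ?_⟩
  · rw [hθmod, hrawroot, toIcoMod_eq_self]
    constructor <;> linarith [Real.pi_pos]
  · have h := toIcoMod_mem_Ico Real.two_pi_pos (-π) (raw i)
    rw [← hθmod, show -π + 2 * π = π by ring] at h
    exact h
  · simp only [hθ]
    rw [flow_sub_zsmul_two_pi C raw k i]
    exact hrawEq i
  · simp only [hθ]
    rw [cos_sub_zsmul_two_pi raw k i (parent i), hstep i hi, hψ]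
    exact cos_branch_nonneg_iff (σ i) (hx i hi)

/-! ### The count -/

/-- Branch patterns normalised at the root: half of all `2ⁿ` Boolean patterns. [folklore]
[cite: DelabaysColettaJacquod2016, Def. 3.7] -/
theorem card_patterns_root_true (root : Fin n) :
    (Finset.univ.filter (fun σ : Fin n → Bool => σ root = true)).card = 2 ^ (n - 1) := by
  classical
  have hn : 1 ≤ n := Nat.succ_le_of_lt (Nat.pos_of_ne_zero (fun h => by subst h; exact Fin.elim0 root))
  -- flipping the root bit is a bijection between the two halves
  have hhalf : (Finset.univ.filter (fun σ : Fin n → Bool => σ root = true)).card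
      = (Finset.univ.filter (fun σ : Fin n → Bool => ¬(σ root = true))).card := by
    refine Finset.card_bij (fun σ _ => Function.update σ root false) ?_ ?_ ?_
    · intro σ _
      simp
    · intro σ₁ h₁ σ₂ h₂ h
      simp only [Finset.mem_filter, Finset.mem_univ, true_and] at h₁ h₂
      funext i
      by_cases hi : i = root
      · subst hi; rw [h₁, h₂]
      · have := congr_fun h i
        rwa [Function.update_of_ne hi, Function.update_of_ne hi] at this
    · intro τ hτ
      simp only [Finset.mem_filter, Finset.mem_univ, true_and, Bool.not_eq_true] at hτ
      refine ⟨Function.update τ root true, by simp, ?_⟩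
      funext i
      by_cases hi : i = root
      · subst hi; simp [hτ]
      · rw [Function.update_of_ne hi, Function.update_of_ne hi]
  have hsum := Finset.card_filter_add_card_filter_not
    (s := (Finset.univ : Finset (Fin n → Bool))) (fun σ : Fin n → Bool => σ root = true)
  rw [Finset.card_univ, Fintype.card_fun, Fintype.card_bool, Fintype.card_fin, ← hhalf] at hsum
  have h2 : 2 ^ n = 2 * 2 ^ (n - 1) := by
    rw [← pow_succ']; congr 1; omega
  omega

/-- **Exactly `2ⁿ⁻¹` synchronous states per period on a radial network with strictly feasible
tree flows** (`n` nodes, `n − 1` edges, two branches per edge): the states pinned at the root in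
the period box `[−π, π)ⁿ` are in bijection with the branch patterns (injective by
`pinned_equilibrium_eq_of_branch_eq`, surjective by `exists_pinned_equilibrium_of_branch`).
Exactly one of them — the all-`+` pattern — is phase-cohesive (`|θᵢ − θⱼ| < π/2` across lines,
(G1) / `PhaseCohesiveEquilibriumUniqueness`); the other `2ⁿ⁻¹ − 1` have an edge with
`cos(θᵢ − θ_{parent i}) < 0`. [folklore: the `2ⁿ⁻¹` count]
[cite: DorflerChertkovBullo2013, SI §3.1 Thm 1 (1), §3.2 Thm 2 (G1)]
[cite: DelabaysColettaJacquod2016, §3 («unique flow distribution» on a tree), Def. 3.7] -/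
theorem ncard_pinned_equilibria_eq {root : Fin n} {parent : Fin n → Fin n}
    {depth : Fin n → ℕ} (hroot : depth root = 0)
    (hdepth : ∀ i, i ≠ root → depth i = depth (parent i) + 1)
    (C : Fin n → Fin n → ℝ) (hC : ∀ i j, C i j = C j i)
    (htree : ∀ i j, i ≠ j → C i j ≠ 0 → (i ≠ root ∧ j = parent i) ∨ (j ≠ root ∧ i = parent j))
    (ha : ∀ i, i ≠ root → 0 < C i (parent i)) (P u : Fin n → ℝ)
    (hcons : ∀ i, P i = (if i ≠ root then u i else 0)
      - ∑ j ∈ Finset.univ.filter (fun j => j ≠ root ∧ parent j = i), u j)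
    (hu : ∀ i, i ≠ root → |u i| < C i (parent i)) :
    {θ : Fin n → ℝ | θ root = 0 ∧ (∀ i, θ i ∈ Set.Ico (-π) π) ∧
      ∀ i, ∑ j, C i j * Real.sin (θ i - θ j) = P i}.ncard = 2 ^ (n - 1) := by
  classical
  set E : Set (Fin n → ℝ) := {θ : Fin n → ℝ | θ root = 0 ∧ (∀ i, θ i ∈ Set.Ico (-π) π) ∧
      ∀ i, ∑ j, C i j * Real.sin (θ i - θ j) = P i} with hE
  set S : Finset (Fin n → Bool) := Finset.univ.filter (fun σ : Fin n → Bool => σ root = true)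
    with hS
  set key : (Fin n → ℝ) → (Fin n → Bool) := fun θ i =>
    if i = root then true else decide (0 ≤ Real.cos (θ i - θ (parent i))) with hkey
  have hmaps : Set.MapsTo key E ↑S := by
    intro θ _
    simp [hS, hkey]
  have hinj : Set.InjOn key E := by
    rintro θ ⟨hr, hbox, heq⟩ θ' ⟨hr', hbox', heq'⟩ hk
    refine pinned_equilibrium_eq_of_branch_eq hdepth C hC htree (fun i hi => (ha i hi).ne') P
      hr hbox heq hr' hbox' heq' fun i hi => ?_
    have h := congr_fun hk i
    simp only [hkey, if_neg hi] at h
    simpa only [decide_eq_decide] using h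
  have hsurj : Set.SurjOn key E ↑S := by
    intro σ hσ
    simp only [hS, Finset.coe_filter, Finset.mem_univ, true_and, Set.mem_setOf_eq] at hσ
    obtain ⟨θ, hr, hbox, heq, hbr⟩ := exists_pinned_equilibrium_of_branch hroot hdepth C hC htree
      ha P u hcons hu σ
    refine ⟨θ, ⟨hr, hbox, heq⟩, ?_⟩
    funext i
    by_cases hi : i = root
    · subst hi; simp [hkey, hσ]
    · simp only [hkey, if_neg hi]
      cases h : σ i
      · simpa [h] using hbr i hi
      · simpa [h] using hbr i hi
  have himage : key '' E = ↑S := (Set.BijOn.mk hmaps hinj hsurj).image_eq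
  rw [← hinj.ncard_image, himage, Set.ncard_coe_finset, card_patterns_root_true]

/-! ## Non-cohesive synchronous states of a tree are not energy minima
(Manik–Timme–Witthaut 2017 Cor. 2: «one is stable and 2ᴺ⁻¹ − 1 are unstable», energy form) -/

/-- Depths do not increase along parent pointers (root pointing to itself). [folklore]
[cite: ManikTimmeWitthaut2017, §5.2 Cor. 2] -/
theorem depth_iterate_parent_le {root : Fin n} {parent : Fin n → Fin n} {depth : Fin n → ℕ}
    (hpr : parent root = root) (hdepth : ∀ i, i ≠ root → depth i = depth (parent i) + 1)
    (m : ℕ) (k : Fin n) : depth (parent^[m] k) ≤ depth k := by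
  induction m generalizing k with
  | zero => simp
  | succ m ih =>
    rw [Function.iterate_succ_apply]
    refine (ih (parent k)).trans ?_
    by_cases hk : k = root
    · subst hk; rw [hpr]
    · have := hdepth k hk; omega

/-- **A synchronous state of a tree with a NEGATIVE-COSINE edge is not a local minimum of the
potential energy** `U(θ) = −Σₖ Pₖθₖ − ½ Σₖ Σₗ Cₖₗ cos(θₖ − θₗ)`: shifting the whole subtree hanging
below that edge by a small angle `t` (sign chosen against `sin` of the edge angle) changes `U` by
`Cᵢ cos φᵢ (1 − cos t) + Cᵢ sin φᵢ (sin t − t) < 0`. Hence of the `2ⁿ⁻¹` synchronous states of a tree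
(`ncard_pinned_equilibria_eq`) only the all-`+` (phase-cohesive) one can be an energy minimum —
the energy form of «one is stable and `2ᴺ⁻¹ − 1` are unstable». Hypotheses: parent pointers with
`parent root = root`, depths, `C` symmetric supported on the tree edges, the equilibrium equations
at every node, the edge `i` live with `cos(θᵢ − θ_{parent i}) < 0`.
[cite: ManikTimmeWitthaut2017, §3 Lemma 1 and §5.2 Cor. 2] [cite: DorflerChertkovBullo2013, SI §3.1] -/
theorem exists_potential_lt_of_neg_branch {root : Fin n} {parent : Fin n → Fin n}
    {depth : Fin n → ℕ} (hpr : parent root = root)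
    (hdepth : ∀ i, i ≠ root → depth i = depth (parent i) + 1)
    (C : Fin n → Fin n → ℝ) (hC : ∀ i j, C i j = C j i)
    (htree : ∀ i j, i ≠ j → C i j ≠ 0 → (i ≠ root ∧ j = parent i) ∨ (j ≠ root ∧ i = parent j))
    (P : Fin n → ℝ) {θ : Fin n → ℝ} (heq : ∀ k, ∑ j, C k j * Real.sin (θ k - θ j) = P k)
    {i : Fin n} (hi : i ≠ root) (hCi : 0 < C i (parent i))
    (hneg : Real.cos (θ i - θ (parent i)) < 0) {ε : ℝ} (hε : 0 < ε) :
    ∃ θ' : Fin n → ℝ, dist θ' θ < ε ∧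
      (-∑ k, P k * θ' k - 1 / 2 * ∑ k, ∑ l, C k l * Real.cos (θ' k - θ' l))
        < (-∑ k, P k * θ k - 1 / 2 * ∑ k, ∑ l, C k l * Real.cos (θ k - θ l)) := by
  classical
  set p := parent i with hp
  have hip : i ≠ p := fun h => parent_ne_self hdepth hi h.symm
  -- the subtree hanging below the edge (i, p)
  set S : Finset (Fin n) := Finset.univ.filter (fun k => ∃ m : ℕ, parent^[m] k = i) with hS
  have hiS : i ∈ S := by
    simp only [hS, Finset.mem_filter, Finset.mem_univ, true_and]; exact ⟨0, rfl⟩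
  have hpS : p ∉ S := by
    simp only [hS, Finset.mem_filter, Finset.mem_univ, true_and, not_exists]
    intro m hm
    have h1 := depth_iterate_parent_le hpr hdepth m p
    rw [hm] at h1
    have h2 := hdepth i hi
    rw [← hp] at h2
    omega
  have hstep : ∀ k, k ≠ i → (k ∈ S ↔ parent k ∈ S) := by
    intro k hki
    simp only [hS, Finset.mem_filter, Finset.mem_univ, true_and]
    constructor
    · rintro ⟨m, hm⟩
      cases m with
      | zero => exact absurd hm hki
      | succ m => exact ⟨m, by rwa [Function.iterate_succ_apply] at hm⟩
    · rintro ⟨m, hm⟩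
      exact ⟨m + 1, by rw [Function.iterate_succ_apply]; exact hm⟩
  -- the direction: indicator of the subtree
  set v : Fin n → ℝ := fun k => if k ∈ S then 1 else 0 with hv
  have hvi : v i = 1 := by simp [hv, hiS]
  have hvp : v p = 0 := by simp [hv, hpS]
  -- across every coupled pair other than the edge (i, p) the direction is constant
  have hvconst : ∀ k l, k ≠ l → C k l ≠ 0 → ¬(k = i ∧ l = p) → ¬(k = p ∧ l = i) → v k = v l := by
    intro k l hkl hCkl h1 h2
    rcases htree k l hkl hCkl with ⟨hk, hl⟩ | ⟨hl, hk⟩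
    · have hki : k ≠ i := fun hki => h1 ⟨hki, by rw [hl, hki]⟩
      have := hstep k hki
      rw [← hl] at this
      simp only [hv]
      by_cases hkS : k ∈ S
      · rw [if_pos hkS, if_pos (this.1 hkS)]
      · rw [if_neg hkS, if_neg (fun hlS => hkS (this.2 hlS))]
    · have hli : l ≠ i := fun hli => h2 ⟨by rw [hk, hli], hli⟩
      have := hstep l hli
      rw [← hk] at this
      simp only [hv]
      by_cases hlS : l ∈ S
      · rw [if_pos (this.1 hlS), if_pos hlS]
      · rw [if_neg (fun hkS => hlS (this.2 hkS)), if_neg hlS]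
  -- the subtree's net injection is the flow on the edge: Σₖ vₖ Pₖ = Cᵢ sin φᵢ
  have hPv : ∑ k, v k * P k = C i p * Real.sin (θ i - θ p) := by
    -- symmetrise the double sum Σₖ vₖ Σₗ Cₖₗ sin(θₖ − θₗ)
    have h1 : ∑ k, v k * P k = ∑ k, ∑ l, v k * (C k l * Real.sin (θ k - θ l)) := by
      refine Finset.sum_congr rfl fun k _ => ?_
      rw [← heq k, Finset.mul_sum]
    have h2 : ∑ k, ∑ l, v k * (C k l * Real.sin (θ k - θ l))
        = -∑ k, ∑ l, v l * (C k l * Real.sin (θ k - θ l)) := by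
      rw [Finset.sum_comm, ← Finset.sum_neg_distrib]
      refine Finset.sum_congr rfl fun k _ => ?_
      rw [← Finset.sum_neg_distrib]
      refine Finset.sum_congr rfl fun l _ => ?_
      rw [hC l k, show θ l - θ k = -(θ k - θ l) by ring, Real.sin_neg]; ring
    have h3 : ∑ k, ∑ l, v k * (C k l * Real.sin (θ k - θ l))
        = 1 / 2 * ∑ k, ∑ l, (v k - v l) * (C k l * Real.sin (θ k - θ l)) := by
      have : ∑ k, ∑ l, (v k - v l) * (C k l * Real.sin (θ k - θ l))
          = ∑ k, ∑ l, v k * (C k l * Real.sin (θ k - θ l))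
            - ∑ k, ∑ l, v l * (C k l * Real.sin (θ k - θ l)) := by
        rw [← Finset.sum_sub_distrib]
        refine Finset.sum_congr rfl fun k _ => ?_
        rw [← Finset.sum_sub_distrib]
        refine Finset.sum_congr rfl fun l _ => ?_
        ring
      rw [this]
      linarith [h2]
    -- only the two orientations of the edge (i, p) survive
    have h4 : ∀ k l, (v k - v l) * (C k l * Real.sin (θ k - θ l))
        = (if k = i ∧ l = p then C i p * Real.sin (θ i - θ p) else 0)
          + (if k = p ∧ l = i then C i p * Real.sin (θ i - θ p) else 0) := by
      intro k l
      by_cases h1 : k = i ∧ l = p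
      · rw [if_pos h1, if_neg (fun h => hip (h1.1.symm.trans h.1)), h1.1, h1.2, hvi, hvp]; ring
      · by_cases h2 : k = p ∧ l = i
        · rw [if_neg h1, if_pos h2, h2.1, h2.2, hvi, hvp, hC p i,
            show θ p - θ i = -(θ i - θ p) by ring, Real.sin_neg]; ring
        · rw [if_neg h1, if_neg h2, add_zero]
          by_cases hkl : k = l
          · subst hkl; simp
          · by_cases hCkl : C k l = 0
            · rw [hCkl]; ring
            · rw [hvconst k l hkl hCkl h1 h2]; ring
    have h5 : ∑ k, ∑ l, (v k - v l) * (C k l * Real.sin (θ k - θ l)) = 2 * (C i p * Real.sin (θ i - θ p)) := by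
      simp_rw [h4, Finset.sum_add_distrib]
      have ha : ∑ k, ∑ l, (if k = i ∧ l = p then C i p * Real.sin (θ i - θ p) else 0) = C i p * Real.sin (θ i - θ p) := by
        rw [Fintype.sum_eq_single i (fun k hk => by simp [hk])]
        simp
      have hb : ∑ k, ∑ l, (if k = p ∧ l = i then C i p * Real.sin (θ i - θ p) else 0) = C i p * Real.sin (θ i - θ p) := by
        rw [Fintype.sum_eq_single p (fun k hk => by simp [hk])]
        simp
      rw [ha, hb]; ring
    rw [h1, h3, h5]; ring
  -- the change of the cosine double sum: only the edge (i, p) moves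
  have hcos : ∀ t : ℝ, ∑ k, ∑ l, C k l * Real.cos ((θ k + t * v k) - (θ l + t * v l))
      = ∑ k, ∑ l, C k l * Real.cos (θ k - θ l)
        + 2 * (C i p * (Real.cos (θ i - θ p + t) - Real.cos (θ i - θ p))) := by
    intro t
    have h4 : ∀ k l, C k l * Real.cos ((θ k + t * v k) - (θ l + t * v l)) - C k l * Real.cos (θ k - θ l)
        = (if k = i ∧ l = p then C i p * (Real.cos (θ i - θ p + t) - Real.cos (θ i - θ p)) else 0)
          + (if k = p ∧ l = i then C i p * (Real.cos (θ i - θ p + t) - Real.cos (θ i - θ p)) else 0) := by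
      intro k l
      by_cases h1 : k = i ∧ l = p
      · rw [if_pos h1, if_neg (fun h => hip (h1.1.symm.trans h.1)), h1.1, h1.2, hvi, hvp,
          show θ i + t * 1 - (θ p + t * 0) = θ i - θ p + t by ring]; ring
      · by_cases h2 : k = p ∧ l = i
        · rw [if_neg h1, if_pos h2, h2.1, h2.2, hvi, hvp, hC p i,
            show θ p + t * 0 - (θ i + t * 1) = -(θ i - θ p + t) by ring, Real.cos_neg,
            show θ p - θ i = -(θ i - θ p) by ring, Real.cos_neg]; ring
        · rw [if_neg h1, if_neg h2, add_zero]
          by_cases hkl : k = l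
          · subst hkl; simp
          · by_cases hCkl : C k l = 0
            · rw [hCkl]; ring
            · rw [hvconst k l hkl hCkl h1 h2]; ring_nf
    have h5 : ∑ k, ∑ l, (C k l * Real.cos ((θ k + t * v k) - (θ l + t * v l)) - C k l * Real.cos (θ k - θ l))
        = 2 * (C i p * (Real.cos (θ i - θ p + t) - Real.cos (θ i - θ p))) := by
      simp_rw [h4, Finset.sum_add_distrib]
      have ha : ∑ k, ∑ l, (if k = i ∧ l = p then C i p * (Real.cos (θ i - θ p + t) - Real.cos (θ i - θ p)) else 0)
          = C i p * (Real.cos (θ i - θ p + t) - Real.cos (θ i - θ p)) := by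
        rw [Fintype.sum_eq_single i (fun k hk => by simp [hk])]
        simp
      have hb : ∑ k, ∑ l, (if k = p ∧ l = i then C i p * (Real.cos (θ i - θ p + t) - Real.cos (θ i - θ p)) else 0)
          = C i p * (Real.cos (θ i - θ p + t) - Real.cos (θ i - θ p)) := by
        rw [Fintype.sum_eq_single p (fun k hk => by simp [hk])]
        simp
      rw [ha, hb]; ring
    have h6 : ∑ k, ∑ l, (C k l * Real.cos ((θ k + t * v k) - (θ l + t * v l)) - C k l * Real.cos (θ k - θ l))
        = ∑ k, ∑ l, C k l * Real.cos ((θ k + t * v k) - (θ l + t * v l))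
          - ∑ k, ∑ l, C k l * Real.cos (θ k - θ l) := by
      rw [← Finset.sum_sub_distrib]
      refine Finset.sum_congr rfl fun k _ => ?_
      rw [← Finset.sum_sub_distrib]
    linarith [h5, h6]
  -- the change of the linear term
  have hlin : ∀ t : ℝ, ∑ k, P k * (θ k + t * v k) = ∑ k, P k * θ k + t * (C i p * Real.sin (θ i - θ p)) := by
    intro t
    rw [← hPv, Finset.mul_sum, ← Finset.sum_add_distrib]
    refine Finset.sum_congr rfl fun k _ => ?_; ring
  -- choose the sign of t against sin φ, and |t| ≤ min (ε/2) 1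
  set τ : ℝ := min (ε / 2) 1 with hτ
  have hτpos : 0 < τ := lt_min (by linarith) one_pos
  have hτle1 : τ ≤ 1 := min_le_right _ _
  have hτε : τ < ε := (min_le_left _ _).trans_lt (by linarith)
  have hcosτ : Real.cos τ < 1 := by
    have := Real.cos_lt_cos_of_nonneg_of_le_pi le_rfl (by linarith [Real.pi_gt_three]) hτpos
    rwa [Real.cos_zero] at this
  have hsinτ : Real.sin τ < τ := Real.sin_lt hτpos
  set t : ℝ := if 0 ≤ Real.sin (θ i - θ p) then τ else -τ with ht
  have htabs : |t| = τ := by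
    simp only [ht]; split_ifs <;> simp [abs_of_pos hτpos]
  have hcost : Real.cos t = Real.cos τ := by
    simp only [ht]; split_ifs <;> simp [Real.cos_neg]
  have hsign : C i p * Real.sin (θ i - θ p) * (Real.sin t - t) ≤ 0 := by
    simp only [ht]
    split_ifs with hs
    · have : Real.sin τ - τ ≤ 0 := by linarith
      exact mul_nonpos_of_nonneg_of_nonpos (mul_nonneg hCi.le hs) this
    · push Not at hs
      rw [Real.sin_neg]
      have h1 : 0 ≤ -Real.sin τ - -τ := by linarith
      have h2 : C i p * Real.sin (θ i - θ p) ≤ 0 := mul_nonpos_of_nonneg_of_nonpos hCi.le hs.le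
      exact mul_nonpos_of_nonpos_of_nonneg h2 h1
  refine ⟨fun k => θ k + t * v k, ?_, ?_⟩
  · -- distance ≤ |t| = τ < ε
    refine lt_of_le_of_lt ((dist_pi_le_iff hτpos.le).2 fun k => ?_) hτε
    rw [Real.dist_eq, show θ k + t * v k - θ k = t * v k by ring, abs_mul, htabs]
    have : |v k| ≤ 1 := by simp only [hv]; split_ifs <;> simp
    nlinarith
  · rw [hcos t, hlin t]
    have hexp : Real.cos (θ i - θ p + t) - Real.cos (θ i - θ p)
        = Real.cos (θ i - θ p) * (Real.cos t - 1) - Real.sin (θ i - θ p) * Real.sin t := by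
      rw [Real.cos_add]; ring
    rw [hexp, hcost]
    have hneg' : C i p * Real.cos (θ i - θ p) * (1 - Real.cos τ) < 0 :=
      mul_neg_of_neg_of_pos (mul_neg_of_pos_of_neg hCi hneg) (by linarith)
    have hsin_t : Real.sin t = (if 0 ≤ Real.sin (θ i - θ p) then Real.sin τ else -Real.sin τ) := by
      simp only [ht]; split_ifs <;> simp [Real.sin_neg]
    nlinarith [hsign, hneg', hsin_t]
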